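import Mathlib
import HarnessLib
import Summits.MatrixMultiplication.MatrixMultiplication.Theorems.OutsiderSandwichSliceGap

/-!
# OutsiderSandwich — pure-product slices of `D^{⊠N}` and the pinning bound for product column spaces
(decomp-mm lens 4 «minimal-counterexample / extremal reduction», gen 40, kernel K40-a; THESES-FREE,
DEFINITION-FREE — conventions of the pencil calculus (Parts I/IIc) and of the slice gap K39-a)

`D` is ANY tensor with `hD : ∀ a b c, D a b c = if a ≠ b ∧ b ≠ c ∧ a ≠ c then 1 else 0` (the
diagonalised Coppersmith–Winograd tensor, `cw₂ ≅ D` over `ℂ`), `D(z) = contract3 D z`,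
`T_N(θ) = contract3 (D^{⊠N}) θ`.  A **pure product** covector is `θ = c · v₁ ⊗ ⋯ ⊗ v_N`, written
`fun f ↦ c * ∏ t, v t (f t)` (no definition is introduced).

* `§1` slices of pure products: `T_N(c · ⊗ v_t)(w, w') = c · ∏_t D(v_t)(w_t, w'_t)`
  (`slice_pureProd_apply`), hence every vector of `col T_N(θ)` is annihilated, at every position `s`,
  by a kernel vector `x̂_s` of `D(v_s)` (`pureProd_vanish`: `∑_b x̂_s(b) · y(w[s ↦ b]) = 0`).
* `§2` **iterated slice gap** (`exists_pureProd_of_rank_lt`): a non-zero covector with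
  `rank T_N(θ) < 1.5 · 2^N` is a pure product all of whose factors have singular slices (K39-a's
  first-letter splitting, iterated).
* `§3` **pinning**: a vector on words of length `N` that satisfies, at every position `t`, linear
  constraints which together with the vanishing of the coordinates in `S_t ⊆ Fin 3` force a letter
  vector to vanish, and which vanishes on the box `∏_t S_t`, is zero (`eq_zero_of_pinned`); so a subspace
  of such vectors has dimension `≤ ∏_t |S_t|` (`finrank_le_prod_card`).
* `§4` the two pins in `ℂ³` (a plane pins to two coordinates, a line to one: `pin_plane`,
  `exists_pin_line`) and the consequence used in K40-b (`finrank_le_two_pow_of_two_positions`): a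
  subspace annihilated at every position by two families `x̂_t, x̂'_t ≠ 0` which are independent at two
  distinct positions `s ≠ s'` has dimension `≤ 2^N` on words of length `N + 2`
  (the product column spaces `⊗_t L_t`, `⊗_t L'_t` of two pure-product slices meet in
  `⊗_t (L_t ∩ L'_t)`, of dimension `2^{N + 2 - #disagreements}`).

References: [cite: CoppersmithWinograd1990, §6]; [cite: BlaserIkenmeyerLysikovPandeySchreyer2019, §5];
[cite: HornJohnson2013, §0.4].
-/

set_option linter.dupNamespace false

noncomputable section

namespace Summit.MatrixMultiplication.MatrixMultiplication.Theorems.OutsiderSandwichProductPinning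

open Literature.Computability.AlgebraicComplexity
open Summit.MatrixMultiplication.MatrixMultiplication.Theorems.OutsiderSandwichPencilBlocks
open Summit.MatrixMultiplication.MatrixMultiplication.Theorems.OutsiderSandwichSliceGap
open scoped Matrix BigOperators

variable {D : Fin 3 → Fin 3 → Fin 3 → ℂ}

/-! ## §1  Slices of pure-product covectors -/

/-- **Slice of a pure product**: `T_N(c · v₁ ⊗ ⋯ ⊗ v_N)(w, w') = c · ∏_t D(v_t)(w_t, w'_t)`
(no hypothesis on `D`). [folklore] -/
theorem slice_pureProd_apply (N : ℕ) (c : ℂ) (v : Fin N → Fin 3 → ℂ) (w w' : Fin N → Fin 3) :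
    contract3 (kroneckerPow D N) (fun f => c * ∏ t, v t (f t)) w w' =
      c * ∏ t, contract3 D (v t) (w t) (w' t) := by
  classical
  rw [slice_apply]
  simp only [contract3_apply]
  rw [Fintype.prod_sum (fun t a => v t a * D a (w t) (w' t)), Finset.mul_sum]
  refine Finset.sum_congr rfl fun f _ => ?_
  rw [Finset.prod_mul_distrib]
  ring

/-- **Annihilation of a product column space**: if `D(v_s) x̂ = 0` then for every vector
`y = T_N(c · ⊗ v_t) u` of the column space and every word `w`, `∑_b x̂(b) · y(w[s ↦ b]) = 0`.
[cite: CoppersmithWinograd1990, §6] -/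
theorem pureProd_vanish (hD : ∀ a b c, D a b c = if a ≠ b ∧ b ≠ c ∧ a ≠ c then 1 else 0)
    (N : ℕ) (c : ℂ) (v : Fin N → Fin 3 → ℂ) (s : Fin N) {x : Fin 3 → ℂ}
    (hx : contract3 D (v s) *ᵥ x = 0) (u : (Fin N → Fin 3) → ℂ) (w : Fin N → Fin 3) :
    ∑ b, x b * (contract3 (kroneckerPow D N) (fun f => c * ∏ t, v t (f t)) *ᵥ u)
      (Function.update w s b) = 0 := by
  classical
  have hx' : x ᵥ* contract3 D (v s) = 0 := by
    rw [← Matrix.mulVec_transpose, dslice_transpose hD]; exact hx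
  have hrow : ∀ a, ∑ b, x b * contract3 D (v s) b a = 0 := fun a => by
    have := congr_fun hx' a
    simpa [Matrix.vecMul, dotProduct] using this
  have hsplit : ∀ (b : Fin 3) (w' : Fin N → Fin 3),
      ∏ t, contract3 D (v t) (Function.update w s b t) (w' t) =
        contract3 D (v s) b (w' s) * ∏ t ∈ Finset.univ \ {s}, contract3 D (v t) (w t) (w' t) := by
    intro b w'
    have h1 : (fun t => contract3 D (v t) (Function.update w s b t) (w' t)) =
        Function.update (fun t => contract3 D (v t) (w t) (w' t)) s (contract3 D (v s) b (w' s)) := by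
      funext t
      exact Function.apply_update (fun t a => contract3 D (v t) a (w' t)) w s b t
    calc ∏ t, contract3 D (v t) (Function.update w s b t) (w' t)
        = ∏ t, (fun t => contract3 D (v t) (Function.update w s b t) (w' t)) t := rfl
      _ = _ := by rw [h1, Finset.prod_update_of_mem (Finset.mem_univ s)]
  simp only [Matrix.mulVec, dotProduct, slice_pureProd_apply, Finset.mul_sum, hsplit]
  rw [Finset.sum_comm]
  refine Finset.sum_eq_zero fun w' _ => ?_
  calc ∑ b, x b * (c * (contract3 D (v s) b (w' s) *
          ∏ t ∈ Finset.univ \ {s}, contract3 D (v t) (w t) (w' t)) * u w')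
      = (∑ b, x b * contract3 D (v s) b (w' s)) *
          (c * (∏ t ∈ Finset.univ \ {s}, contract3 D (v t) (w t) (w' t)) * u w') := by
        rw [Finset.sum_mul]
        exact Finset.sum_congr rfl fun b _ => by ring
    _ = 0 := by rw [hrow (w' s), zero_mul]

/-- A pure product with a vanishing factor vanishes; contrapositively the factors of a non-zero pure
product are non-zero. [folklore] -/
theorem factor_ne_zero {N : ℕ} {c : ℂ} {v : Fin N → Fin 3 → ℂ} {θ : (Fin N → Fin 3) → ℂ}
    (hθ : θ = fun f => c * ∏ t, v t (f t)) (h0 : θ ≠ 0) (t : Fin N) : v t ≠ 0 := by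
  intro hv
  apply h0
  rw [hθ]
  funext f
  rw [Finset.prod_eq_zero (Finset.mem_univ t) (by rw [hv]; rfl), mul_zero]
  rfl

/-- The scalar of a non-zero pure product is non-zero. [folklore] -/
theorem scalar_ne_zero {N : ℕ} {c : ℂ} {v : Fin N → Fin 3 → ℂ} {θ : (Fin N → Fin 3) → ℂ}
    (hθ : θ = fun f => c * ∏ t, v t (f t)) (h0 : θ ≠ 0) : c ≠ 0 := by
  rintro rfl
  apply h0
  rw [hθ]
  funext f
  rw [zero_mul]
  rfl

/-! ## §2  The iterated slice gap -/

/-- **Iterated slice gap.**  A non-zero covector `θ` on words of length `N` with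
`2 · rank T_N(θ) < 3 · 2^N` is a pure product `c · v₁ ⊗ ⋯ ⊗ v_N` every factor of which has a
singular slice: `D(v_t) x̂_t = 0` for some `x̂_t ≠ 0`. (K39-a's first-letter splitting
`exists_prod_of_rank_lt`, iterated: the tail inherits `2 · rank < 3 · 2^{N-1}`.)
[cite: CoppersmithWinograd1990, §6] -/
theorem exists_pureProd_of_rank_lt
    (hD : ∀ a b c, D a b c = if a ≠ b ∧ b ≠ c ∧ a ≠ c then 1 else 0) :
    ∀ (N : ℕ) (θ : (Fin N → Fin 3) → ℂ), θ ≠ 0 →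
      2 * (contract3 (kroneckerPow D N) θ).rank < 3 * 2 ^ N →
      ∃ (c : ℂ) (v : Fin N → Fin 3 → ℂ), (θ = fun f => c * ∏ t, v t (f t)) ∧
        ∀ t, ∃ x : Fin 3 → ℂ, x ≠ 0 ∧ contract3 D (v t) *ᵥ x = 0 := by
  intro N
  induction N with
  | zero =>
    intro θ _ _
    refine ⟨θ default, fun t => Fin.elim0 t, ?_, fun t => Fin.elim0 t⟩
    funext f
    rw [Subsingleton.elim f default]
    simp
  | succ N ih =>
    intro θ hθ hr
    have h2 : 2 ^ (N + 1) = 2 * 2 ^ N := by ring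
    have hr' : (contract3 (kroneckerPow D (N + 1)) θ).rank < 3 * 2 ^ N := by omega
    obtain ⟨lam, ζ, a, hlam, hζ, hprod, hrk⟩ := exists_prod_of_rank_lt hD N θ hθ hr'
    obtain ⟨c, v, hζv, hv⟩ := ih ζ hζ (by omega)
    obtain ⟨x, hx0, hx⟩ := exists_mulVec_eq_zero_of_coord hD a hlam
    refine ⟨c, Fin.cons lam v, ?_, ?_⟩
    · rw [hprod]
      funext f
      rw [hζv]
      simp only [Fin.prod_univ_succ, Fin.cons_zero, Fin.cons_succ, Fin.tail]
      ring
    · refine Fin.cases ?_ fun t => ?_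
      · exact ⟨x, hx0, by simpa using hx⟩
      · simpa using hv t

/-! ## §3  Pinning: vanishing on a box of letters forces vanishing -/

/-- **Peeling lemma.**  Let, at every position `t`, a set `X_t` of letter covectors and a set
`S_t ⊆ Fin 3` of letters be given such that a letter vector orthogonal to `X_t` and vanishing on `S_t`
vanishes.  Then a vector on words of length `N` that is annihilated by `X_t` at position `t` (for all
`t`) and vanishes on the box `∏_t S_t` is zero.  (Induction on `N`, splitting off the first letter.)
[folklore] -/
theorem eq_zero_of_pinned :
    ∀ (N : ℕ) (S : Fin N → Finset (Fin 3)) (X : Fin N → Set (Fin 3 → ℂ)),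
      (∀ t (y : Fin 3 → ℂ), (∀ x ∈ X t, ∑ b, x b * y b = 0) → (∀ b ∈ S t, y b = 0) → y = 0) →
      ∀ u : (Fin N → Fin 3) → ℂ,
      (∀ t, ∀ x ∈ X t, ∀ w, ∑ b, x b * u (Function.update w t b) = 0) →
      (∀ w, (∀ t, w t ∈ S t) → u w = 0) → u = 0 := by
  intro N
  induction N with
  | zero =>
    intro S X _ u _ hbox
    funext w
    exact hbox w fun t => Fin.elim0 t
  | succ N ih =>
    intro S X hpin u hX hbox
    -- the first-letter components `u_c`, `c ∈ S 0`, vanish by induction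
    have hcomp : ∀ c ∈ S 0, (fun w' : Fin N → Fin 3 => u (Fin.cons c w')) = 0 := by
      intro c hc
      refine ih (fun t => S t.succ) (fun t => X t.succ) (fun t => hpin t.succ) _ ?_ ?_
      · intro t x hx w'
        have h := hX t.succ x hx (Fin.cons c w')
        simpa only [← Fin.cons_update (α := fun _ => Fin 3)] using h
      · intro w' hw'
        refine hbox (Fin.cons c w') (Fin.cases ?_ fun t => ?_)
        · simpa using hc
        · simpa using hw' t
    -- hence every letter vector `c ↦ u (c :: w')` is pinned to zero
    funext f
    have hy : (fun c => u (Fin.cons c (Fin.tail f))) = 0 := by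
      refine hpin 0 _ (fun x hx => ?_) (fun b hb => congr_fun (hcomp b hb) (Fin.tail f))
      have h := hX 0 x hx f
      have hf : ∀ b, Function.update f 0 b = Fin.cons b (Fin.tail f) := fun b => by
        conv_lhs => rw [← Fin.cons_self_tail f]
        exact Fin.update_cons_zero (α := fun _ => Fin 3) _ _ _
      simpa only [hf] using h
    have := congr_fun hy (f 0)
    simpa only [Fin.cons_self_tail, Pi.zero_apply] using this

/-- **Pinning bound.**  Under the hypotheses of `eq_zero_of_pinned`, a subspace of vectors annihilated
by `X_t` at every position `t` has dimension at most `∏_t |S_t|` (restriction to the box is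
injective). [folklore] -/
theorem finrank_le_prod_card (N : ℕ) (S : Fin N → Finset (Fin 3)) (X : Fin N → Set (Fin 3 → ℂ))
    (hpin : ∀ t (y : Fin 3 → ℂ), (∀ x ∈ X t, ∑ b, x b * y b = 0) → (∀ b ∈ S t, y b = 0) → y = 0)
    (V : Submodule ℂ ((Fin N → Fin 3) → ℂ))
    (hV : ∀ u ∈ V, ∀ t, ∀ x ∈ X t, ∀ w, ∑ b, x b * u (Function.update w t b) = 0) :
    Module.finrank ℂ V ≤ ∏ t, (S t).card := by
  classical
  let ρ : ((Fin N → Fin 3) → ℂ) →ₗ[ℂ] ({w : Fin N → Fin 3 // ∀ t, w t ∈ S t} → ℂ) :=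
    LinearMap.funLeft ℂ ℂ Subtype.val
  have hinj : Function.Injective (ρ ∘ₗ V.subtype) := by
    refine (injective_iff_map_eq_zero _).mpr ?_
    rintro ⟨u, hu⟩ h0
    apply Subtype.ext
    refine eq_zero_of_pinned N S X hpin u (hV u hu) fun w hw => ?_
    have := congr_fun h0 ⟨w, hw⟩
    simpa [ρ] using this
  have h := LinearMap.finrank_le_finrank_of_injective hinj
  rw [Module.finrank_fintype_fun_eq_card,
    Fintype.card_congr (Equiv.subtypePiEquivPi (p := fun t b => b ∈ S t)), Fintype.card_pi] at h
  simpa using h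

/-! ## §4  The two pins in `ℂ³` and the two-position bound -/

/-- **A plane pins to two coordinates**: if `x̂_a ≠ 0`, a letter vector orthogonal to `x̂` whose
coordinates other than `a` vanish is zero. [folklore] -/
theorem pin_plane {x : Fin 3 → ℂ} {a : Fin 3} (ha : x a ≠ 0) (y : Fin 3 → ℂ)
    (h1 : ∑ b, x b * y b = 0) (h2 : ∀ b ∈ Finset.univ.erase a, y b = 0) : y = 0 := by
  have h2' : ∀ b, b ≠ a → y b = 0 := fun b hb => h2 b (Finset.mem_erase.mpr ⟨hb, Finset.mem_univ b⟩)
  have hya : y a = 0 := by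
    rw [Finset.sum_eq_single a (fun b _ hb => by rw [h2' b hb, mul_zero]) (by simp)] at h1
    exact (mul_eq_zero.mp h1).resolve_left ha
  funext b
  by_cases hb : b = a
  · rw [hb]; exact hya
  · exact h2' b hb

/-- **A line pins to one coordinate**: for independent `x̂, x̂'` there is a letter `a` such that a
letter vector orthogonal to `x̂` and `x̂'` with vanishing `a`-th coordinate is zero (complete `x̂, x̂'`
by a coordinate vector `e_a` to a basis of `ℂ³`). [cite: HornJohnson2013, §0.4] -/
theorem exists_pin_line {x x' : Fin 3 → ℂ} (h : LinearIndependent ℂ ![x, x']) :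
    ∃ a : Fin 3, ∀ y : Fin 3 → ℂ, ∑ b, x b * y b = 0 → ∑ b, x' b * y b = 0 → y a = 0 → y = 0 := by
  classical
  obtain ⟨a, ha⟩ : ∃ a : Fin 3,
      (fun j => if a = j then (1 : ℂ) else 0) ∉ Submodule.span ℂ (Set.range ![x, x']) := by
    by_contra hall
    push Not at hall
    have htop : (⊤ : Submodule ℂ (Fin 3 → ℂ)) ≤ Submodule.span ℂ (Set.range ![x, x']) := by
      intro y _
      rw [pi_eq_sum_univ y]
      exact Submodule.sum_mem _ fun a _ => Submodule.smul_mem _ _ (hall a)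
    have h2 := Submodule.finrank_mono htop
    rw [finrank_top, finrank_span_eq_card h, Module.finrank_fintype_fun_eq_card] at h2
    simp at h2
  refine ⟨a, fun y h1 h2 h3 => ?_⟩
  have hP : LinearIndependent ℂ ![fun j => if a = j then (1 : ℂ) else 0, x, x'] :=
    linearIndependent_finCons.mpr ⟨h, ha⟩
  have hPu : IsUnit (Matrix.of ![fun j => if a = j then (1 : ℂ) else 0, x, x']) :=
    Matrix.linearIndependent_rows_iff_isUnit.mp hP
  have hdet : (Matrix.of ![fun j => if a = j then (1 : ℂ) else 0, x, x']).det ≠ 0 :=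
    ((Matrix.isUnit_iff_isUnit_det _).mp hPu).ne_zero
  refine Matrix.eq_zero_of_mulVec_eq_zero hdet (v := y) ?_
  funext k
  fin_cases k
  · simp [Matrix.mulVec, dotProduct, Finset.sum_ite_eq, h3]
  · simpa [Matrix.mulVec, dotProduct] using h1
  · simpa [Matrix.mulVec, dotProduct] using h2

/-- **Two-position bound.**  Let `V` be a subspace of vectors on words of length `N + 2` annihilated,
at every position `t`, by two non-zero letter covectors `x̂_t` and `x̂'_t`
(`∑_b x̂_t(b) · u(w[t ↦ b]) = 0`, likewise for `x̂'_t`).  If `x̂_s, x̂'_s` are independent and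
`x̂_{s'}, x̂'_{s'}` are independent for two positions `s ≠ s'`, then `dim V ≤ 2^N`.
(Pin a line at `s, s'` and a plane elsewhere: the box has `1 · 1 · 2^N` letters.)
[cite: HornJohnson2013, §0.4] -/
theorem finrank_le_two_pow_of_two_positions (N : ℕ) (x x' : Fin (N + 2) → Fin 3 → ℂ)
    (hx0 : ∀ t, x t ≠ 0) {s s' : Fin (N + 2)} (hss : s ≠ s')
    (hs : LinearIndependent ℂ ![x s, x' s]) (hs' : LinearIndependent ℂ ![x s', x' s'])
    (V : Submodule ℂ ((Fin (N + 2) → Fin 3) → ℂ))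
    (hV : ∀ u ∈ V, ∀ t w, ∑ b, x t b * u (Function.update w t b) = 0 ∧
      ∑ b, x' t b * u (Function.update w t b) = 0) :
    Module.finrank ℂ V ≤ 2 ^ N := by
  classical
  obtain ⟨a₁, ha₁⟩ := exists_pin_line hs
  obtain ⟨a₂, ha₂⟩ := exists_pin_line hs'
  have hcoord : ∀ t, ∃ a : Fin 3, x t a ≠ 0 := fun t => by
    by_contra h
    push Not at h
    exact hx0 t (funext h)
  choose ap hap using hcoord
  let S : Fin (N + 2) → Finset (Fin 3) := fun t =>
    if t = s then {a₁} else if t = s' then {a₂} else Finset.univ.erase (ap t)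
  have hbound := finrank_le_prod_card (N + 2) S (fun t => {x t, x' t}) (fun t y hy hS => ?_) V
    (fun u hu t z hz w => ?_)
  · -- the box has `2^N` letters
    have hS1 : (S s).card = 1 := by simp [S]
    have hS2 : (S s').card = 1 := by simp [S, Ne.symm hss]
    have hS3 : ∀ t ∈ (Finset.univ.erase s).erase s', (S t).card = 2 := by
      intro t ht
      simp only [Finset.mem_erase, Finset.mem_univ, and_true] at ht
      simp [S, ht.1, ht.2, Finset.card_erase_of_mem]
    have hprod : ∏ t, (S t).card = 2 ^ N := by
      rw [← Finset.mul_prod_erase _ _ (Finset.mem_univ s), hS1, one_mul,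
        ← Finset.mul_prod_erase _ _ (Finset.mem_erase.mpr ⟨Ne.symm hss, Finset.mem_univ s'⟩), hS2,
        one_mul, Finset.prod_congr rfl hS3, Finset.prod_const, Finset.card_erase_of_mem
          (Finset.mem_erase.mpr ⟨Ne.symm hss, Finset.mem_univ s'⟩),
        Finset.card_erase_of_mem (Finset.mem_univ s), Finset.card_univ, Fintype.card_fin]
      have hN : N + 2 - 1 - 1 = N := by omega
      rw [hN]
    rw [hprod] at hbound
    exact hbound
  · -- the pins
    have hyx : ∑ b, x t b * y b = 0 := hy (x t) (by simp)
    have hyx' : ∑ b, x' t b * y b = 0 := hy (x' t) (by simp)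
    by_cases hts : t = s
    · subst hts
      refine ha₁ y hyx hyx' (hS a₁ ?_)
      simp [S]
    · by_cases hts' : t = s'
      · subst hts'
        refine ha₂ y hyx hyx' (hS a₂ ?_)
        simp [S, hts]
      · refine pin_plane (hap t) y hyx fun b hb => hS b ?_
        simpa [S, hts, hts'] using hb
  · -- the annihilation hypotheses
    rcases hz with rfl | rfl
    · exact (hV u hu t w).1
    · exact (hV u hu t w).2

end Summit.MatrixMultiplication.MatrixMultiplication.Theorems.OutsiderSandwichProductPinning
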